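import Mathlib
import Literature.AlgebraicGeometry.Resolution.RegularSystemOfParameters
import Literature.AlgebraicGeometry.Resolution.RegularLocalRingsProofs
import HarnessLib

/-!
# Route `RadicialJung`, crux `CleanModels` (stmt-15917) — (C-curve) sub-line, shared brick: the local ring of the regular centre curve is a DVR

Lead `res-B-lead-1` g6 (plan `Cruxes/CleanModels/Lines/Sketch-memo-Ccurve-plan.md` §1 S5₀/S5a).  OURS · counted 0.  Nothing here proves resolution in
characteristic `p`; resolution in char `p` is NOT proved.

For a regular local ring `S` of dimension 3 with regular system of parameters `(t₀, t₁, t₂)`: the quotient `S ⧸ (t₀, t₁)` — the local ring `O_{C,P}` of the centre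
curve `C = V(t₀, t₁)` in the (C-curve) persist — is a DISCRETE VALUATION RING with uniformizer the image of `t₂` (`quotient_span_pair_dvr`), and a residue-perfectness
hypothesis on `S` («every element is a `p`-th power modulo `𝔪`») passes to the quotient (`quotient_residue_pth_powers`).  Consumers: `stub_Cc_persistForm1/2/3` (the orders
`ord_z̄` of `v₁`-units of `S` along the curve; ✓ `Ccurve.exists_sub_pow_eq_unit_mul_pow_of_finrank` at `D = S ⧸ (t₀, t₁)`).
-/

noncomputable section

set_option linter.dupNamespace false

open IsLocalRing Literature.AlgebraicGeometry.Resolution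

namespace Summit.ResolutionOfSingularities.ResolutionOfSingularities.Theorems.RadicialJung.CleanModels.Ccurve

variable {S : Type} [CommRing S] [IsRegularLocalRing S]

omit [CommRing S] [IsRegularLocalRing S] in
/-- The index pair `{0, 1} ⊂ Fin 3` and its image `{t₀, t₁}`. [folklore] -/
theorem image_pair (t : Fin 3 → S) : t '' ((({0, 1} : Finset (Fin 3)) : Set (Fin 3))) = {t 0, t 1} := by
  rw [Finset.coe_insert, Finset.coe_singleton, Set.image_insert_eq, Set.image_singleton]

/-- **`S ⧸ (t₀, t₁)` is a discrete valuation ring with uniformizer `t̄₂`** for a regular local ring `S` with regular system of parameters `(t₀, t₁, t₂)`: the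
quotient is a regular local domain (Matsumura 14.2/14.3, tree ✓ `isRegularLocalRing_quotient_span_image`), its maximal ideal is generated by `t̄₂ ≠ 0`, hence it is a
DVR (Mathlib `IsDiscreteValuationRing.TFAE`). [folklore] -/
theorem quotient_span_pair_dvr (hd : (maximalIdeal S).spanFinrank = 3) (t : Fin 3 → S)
    (ht : Ideal.span (Set.range t) = maximalIdeal S) :
    ∃ (_ : IsDomain (S ⧸ Ideal.span ({t 0, t 1} : Set S))),
      IsDiscreteValuationRing (S ⧸ Ideal.span ({t 0, t 1} : Set S)) ∧
      Irreducible (Ideal.Quotient.mk (Ideal.span ({t 0, t 1} : Set S)) (t 2)) := by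
  classical
  set P : Ideal S := Ideal.span ({t 0, t 1} : Set S) with hP
  have hPimg : Ideal.span (t '' ((({0, 1} : Finset (Fin 3)) : Set (Fin 3)))) = P := by rw [image_pair]
  haveI hreg : IsRegularLocalRing (S ⧸ P) := by
    rw [← hPimg]; exact isRegularLocalRing_quotient_span_image hd t ht _
  haveI : IsDomain (S ⧸ P) := isDomain_of_isRegularLocalRing _
  -- `t₂ ∉ (t₀, t₁)`
  have ht2 : t 2 ∉ P := by
    rw [← hPimg]
    exact not_mem_span_image_of_not_mem hd t ht (by decide)
  have hz0 : Ideal.Quotient.mk P (t 2) ≠ 0 := by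
    rwa [Ne, Ideal.Quotient.eq_zero_iff_mem]
  -- the maximal ideal of the quotient is `(t̄₂)`
  haveI : IsLocalHom (Ideal.Quotient.mk P) := IsLocalHom.of_surjective _ Ideal.Quotient.mk_surjective
  have hmax : maximalIdeal (S ⧸ P) = Ideal.span {Ideal.Quotient.mk P (t 2)} := by
    have h1 : maximalIdeal (S ⧸ P) = (maximalIdeal S).map (Ideal.Quotient.mk P) := by
      rw [← IsLocalRing.maximalIdeal_comap (Ideal.Quotient.mk P),
        Ideal.map_comap_of_surjective _ Ideal.Quotient.mk_surjective]
    rw [h1, ← ht, Ideal.map_span]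
    apply le_antisymm
    · rw [Ideal.span_le]
      rintro _ ⟨_, ⟨i, rfl⟩, rfl⟩
      have h0 : Ideal.Quotient.mk P (t 0) = 0 := Ideal.Quotient.eq_zero_iff_mem.mpr (Ideal.subset_span (by simp))
      have h1' : Ideal.Quotient.mk P (t 1) = 0 := Ideal.Quotient.eq_zero_iff_mem.mpr (Ideal.subset_span (by simp))
      fin_cases i
      · show Ideal.Quotient.mk P (t 0) ∈ _
        rw [h0]; exact Ideal.zero_mem _
      · show Ideal.Quotient.mk P (t 1) ∈ _
        rw [h1']; exact Ideal.zero_mem _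
      · exact Ideal.subset_span rfl
    · rw [Ideal.span_le, Set.singleton_subset_iff]
      exact Ideal.subset_span ⟨t 2, ⟨2, rfl⟩, rfl⟩
  have hnf : ¬ IsField (S ⧸ P) := by
    rw [IsLocalRing.isField_iff_maximalIdeal_eq, hmax, Ideal.span_singleton_eq_bot]
    exact hz0
  have hprinc : (maximalIdeal (S ⧸ P)).IsPrincipal := ⟨⟨Ideal.Quotient.mk P (t 2), hmax⟩⟩
  have hdvr : IsDiscreteValuationRing (S ⧸ P) := ((IsDiscreteValuationRing.TFAE (S ⧸ P) hnf).out 0 4).mpr hprinc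
  exact ⟨inferInstance, hdvr, IsDiscreteValuationRing.irreducible_of_span_eq_maximalIdeal _ hz0 hmax⟩

omit [IsRegularLocalRing S] in
/-- Residue-perfectness passes to quotients: if every element of the local ring `S` is a `p`-th power modulo `𝔪_S`, the same holds in `S ⧸ P` for
`P ≤ 𝔪_S`-style quotients (any proper quotient that is local with `𝔪_{S/P} = 𝔪_S / P`). [folklore] -/
theorem quotient_residue_pth_powers [IsLocalRing S] (p : ℕ) (P : Ideal S) [IsLocalRing (S ⧸ P)]
    (hperf : ∀ u : S, ∃ e : S, u - e ^ p ∈ maximalIdeal S) :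
    ∀ u : S ⧸ P, ∃ e : S ⧸ P, u - e ^ p ∈ maximalIdeal (S ⧸ P) := by
  haveI : Nontrivial (S ⧸ P) := inferInstance
  haveI : IsLocalHom (Ideal.Quotient.mk P) := IsLocalHom.of_surjective _ Ideal.Quotient.mk_surjective
  intro u
  obtain ⟨u, rfl⟩ := Ideal.Quotient.mk_surjective u
  obtain ⟨e, he⟩ := hperf u
  refine ⟨Ideal.Quotient.mk P e, ?_⟩
  rw [← map_pow, ← map_sub]
  exact IsLocalRing.map_maximalIdeal_le (Ideal.Quotient.mk P) (Ideal.mem_map_of_mem _ he)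

end Summit.ResolutionOfSingularities.ResolutionOfSingularities.Theorems.RadicialJung.CleanModels.Ccurve

end
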